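import Literature.NumberTheory.Automorphic.AdeleAddCharGaloisEquivariance    -- ★ local equivariance `adeleAddCharAt_galAdicCompletionMap`
import Literature.NumberTheory.Automorphic.AdeleAddCharClassification       -- ★ Tate's Thm. 4.1.4 `IsGlobalAddChar.existsUnique_eq_mulShift_adeleAddChar`
import Literature.NumberTheory.Automorphic.AdelePlacesIdempotent            -- ★ `adeleSingleHom_smul`
import Literature.NumberTheory.Automorphic.AutomorphicGaloisConj             -- ★ the action `σ • x` on `𝔸_E`, `smul_adeleSingleHom`
import HarnessLib

/-!
# Galois invariance of Tate's standard character: `ψ_E(σ x) = ψ_E(x)` for `σ ∈ Aut(E/F)`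

Topic `NumberTheory/Automorphic`; namespace `Literature.NumberTheory.Automorphic`.  KERNEL mathematics only (theorems; no definition, no named
fact, no instance, no `sorry`).  Sequel to ★ `AdeleAddCharGaloisEquivariance` (the LOCAL statement `ψ_{σ w}(σ_w x) = ψ_w(x)` at finite places).

For a number field `E`, a subfield `F` and `σ ∈ Aut(E/F)` acting on `𝔸_E = E_∞ × 𝔸_E^∞` componentwise (★ `GaloisActionAdeleRing`,
`instMulSemiringActionAdeleRing`), Tate's character `ψ_E = e^{2πiΛ}` (★ `adeleAddChar E`) is `σ`-INVARIANT:

* `adeleAddChar_smul` — **`ψ_E(σ • x) = ψ_E(x)`** for every `x ∈ 𝔸_E`.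

This is [Tate1950] §2.2 with §4.1 («`Λ = Σ_𝔭 λ_p ∘ Tr_{E_𝔭/ℚ_p}`», and the trace is Galois invariant), equivalently [WeilBNT1967, Ch. IV §2, Cor. 3
of Th. 3 with Ch. VIII §4].  PROOF (no archimedean computation): `χ := ψ_E ∘ σ` is again a GLOBAL additive character (continuous, trivial on `E`
since `σ E = E`, non-trivial), so by Tate's Theorem 4.1.4 (★ `IsGlobalAddChar.exists_eq_mulShift_adeleAddChar`) `χ = ψ_E(ξ ·)` for some `ξ ∈ E^×`;
restricting to ONE finite place `w` through the factor inclusion `ι_w` (★ `adeleSingleHom`; `σ • ι_w(y) = ι_{σw}(σ_w y)`, ★ `FiniteAdeleRing.smul_single`)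
the local equivariance ★ `adeleAddCharAt_galAdicCompletionMap` gives `ψ_w(ξ y) = ψ_w(y)` for all `y ∈ E_w`, whence `ξ = 1` because `ψ_w` is
non-trivial (★ `exists_adeleAddCharAt_ne_one`).

Consequences typed here for the users (CM fields, hermitian Fourier analysis of the pub-hodgecm-mathlib K2 road): `adeleAddChar_sub_smul`
(`ψ_E(x − σx) = 1`), and for an INVOLUTION `σ`: `adeleAddChar_eq_one_of_smul_eq_neg` (**`ψ_E` kills the `σ`-anti-invariant adeles**
`σ x = −x`, as `x = x∕2 − σ(x∕2)`) and `adeleAddChar_add_smul` (`ψ_E(x + σ x) = ψ_E(x)²`).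

## References
* [Tate1950] J. Tate, *Fourier analysis in number fields and Hecke's zeta-functions* (1950), in Cassels–Fröhlich (eds.), *Algebraic Number Theory*
  (1967), Ch. XV: §2.2, §4.1 (Thm. 4.1.4).
* [WeilBNT1967] A. Weil, *Basic Number Theory*, Grundlehren 144 (1967), Ch. IV §2.
* [CasselsFrohlichANT1967] J. W. S. Cassels, A. Fröhlich (eds.), *Algebraic Number Theory* (1967), Ch. VII §1.1 (conjugate places).
-/

set_option autoImplicit false

noncomputable section

open NumberField IsDedekindDomain

namespace Literature.NumberTheory.Automorphic

variable (F : Type) [Field F] [CharZero F] {E : Type} [Field E] [NumberField E] [Algebra F E]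

/-- `ψ_E ∘ σ` evaluated on a factor: `ψ_E(σ • ι_w(y)) = ψ_w(y)` (★ local equivariance `adeleAddCharAt_galAdicCompletionMap`).
[cite: Tate1950, §2.2] -/
theorem adeleAddChar_smul_adeleSingleHom (σ : E ≃ₐ[F] E) (w : HeightOneSpectrum (𝓞 E)) (y : w.adicCompletion E) :
    adeleAddChar E (σ • adeleSingleHom E w y) = adeleAddCharAt E w y := by
  rw [smul_adeleSingleHom F σ w y, ← adeleAddCharAt_apply, adeleAddCharAt_galAdicCompletionMap F σ rfl y]

omit [CharZero F] in
/-- `ψ_E ∘ σ` is a global additive character of `E` (continuous, trivial on `E`, non-trivial). [cite: Tate1950, §4.1, Thm. 4.1.4] -/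
theorem isGlobalAddChar_adeleAddChar_comp_smul (σ : E ≃ₐ[F] E) :
    IsGlobalAddChar E ((adeleAddChar E).compAddMonoidHom (MulSemiringAction.toRingHom (E ≃ₐ[F] E) (AdeleRing (𝓞 E) E) σ).toAddMonoidHom) where
  continuous := (continuous_adeleAddChar E).comp (AdeleRing.continuous_smul F σ)
  map_algebraMap k := by
    rw [AddChar.compAddMonoidHom_apply, RingHom.toAddMonoidHom_eq_coe, AddMonoidHom.coe_coe, MulSemiringAction.toRingHom_apply,
      AdeleRing.smul_algebraMap, adeleAddChar_algebraMap]
  ne_one := by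
    obtain ⟨x, hx⟩ := (isGlobalAddChar_adeleAddChar E).exists_apply_ne_one
    rw [AddChar.ne_one_iff]
    refine ⟨σ⁻¹ • x, ?_⟩
    rwa [AddChar.compAddMonoidHom_apply, RingHom.toAddMonoidHom_eq_coe, AddMonoidHom.coe_coe, MulSemiringAction.toRingHom_apply, smul_inv_smul]

/-- **GALOIS INVARIANCE OF TATE'S CHARACTER: `ψ_E(σ • x) = ψ_E(x)`** for every `σ ∈ Aut(E/F)` and `x ∈ 𝔸_E`.  (`ψ_E ∘ σ = ψ_E(ξ ·)` by Tate's
Theorem 4.1.4; testing on the factor `E_w ↪ 𝔸_E` at one finite place with the local equivariance `ψ_{σw}(σ_w y) = ψ_w(y)` gives `ψ_w(ξ y) = ψ_w(y)`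
for all `y`, so `ξ = 1` by the non-triviality of `ψ_w`.) [cite: Tate1950, §2.2, §4.1 Thm. 4.1.4] [cite: WeilBNT1967, Ch. IV §2] -/
theorem adeleAddChar_smul (σ : E ≃ₐ[F] E) (x : AdeleRing (𝓞 E) E) : adeleAddChar E (σ • x) = adeleAddChar E x := by
  set χ : AddChar (AdeleRing (𝓞 E) E) Circle :=
    (adeleAddChar E).compAddMonoidHom (MulSemiringAction.toRingHom (E ≃ₐ[F] E) (AdeleRing (𝓞 E) E) σ).toAddMonoidHom with hχdef
  have hχ : ∀ z, χ z = adeleAddChar E (σ • z) := fun z => rfl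
  obtain ⟨ξ, -, hξ⟩ := (isGlobalAddChar_adeleAddChar_comp_smul F σ).exists_eq_mulShift_adeleAddChar
  -- one finite place
  obtain ⟨w⟩ : Nonempty (HeightOneSpectrum (𝓞 E)) := by
    obtain ⟨𝔪, h𝔪⟩ := Ideal.exists_maximal (𝓞 E)
    exact ⟨⟨𝔪, h𝔪.isPrime, Ring.ne_bot_of_isMaximal_of_not_isField h𝔪 (RingOfIntegers.not_isField E)⟩⟩
  -- `ψ_w(ξ y) = ψ_w(y)` for all `y ∈ E_w`
  have hloc : ∀ y : w.adicCompletion E, adeleAddCharAt E w (ξ • y) = adeleAddCharAt E w y := by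
    intro y
    have h1 := DFunLike.congr_fun hξ (adeleSingleHom E w y)
    rw [hχ, adeleAddChar_smul_adeleSingleHom F σ w y, AddChar.mulShift_apply, ← Algebra.smul_def, ← adeleSingleHom_smul,
      ← adeleAddCharAt_apply] at h1
    exact h1.symm
  -- hence `ξ = 1`
  have hξ1 : ξ = 1 := by
    by_contra hne
    obtain ⟨u, hu⟩ := exists_adeleAddCharAt_ne_one E w
    have hne' : ((ξ : E) : w.adicCompletion E) - 1 ≠ 0 := by
      rw [sub_ne_zero, ne_eq, ← map_one (algebraMap E (w.adicCompletion E)), show ((ξ : E) : w.adicCompletion E) = algebraMap E _ ξ from rfl]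
      exact fun h => hne ((algebraMap E (w.adicCompletion E)).injective h)
    set y : w.adicCompletion E := (((ξ : E) : w.adicCompletion E) - 1)⁻¹ * u with hy
    have h2 := hloc y
    rw [Algebra.smul_def, show algebraMap E (w.adicCompletion E) ξ = ((ξ : E) : w.adicCompletion E) from rfl,
      show ((ξ : E) : w.adicCompletion E) * y = (((ξ : E) : w.adicCompletion E) - 1) * y + y by ring, AddChar.map_add_eq_mul,
      mul_eq_right, hy, ← mul_assoc, mul_inv_cancel₀ hne', one_mul] at h2
    exact hu h2
  have h3 := DFunLike.congr_fun hξ x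
  rw [hχ, hξ1, map_one, AddChar.mulShift_apply, one_mul] at h3
  exact h3

/-- `ψ_E(x − σ • x) = 1`. [cite: Tate1950, §2.2] -/
theorem adeleAddChar_sub_smul (σ : E ≃ₐ[F] E) (x : AdeleRing (𝓞 E) E) : adeleAddChar E (x - σ • x) = 1 := by
  rw [AddChar.map_sub_eq_div, adeleAddChar_smul F σ x, div_self']

/-- `ψ_E(x + σ • x) = ψ_E(x)²`. [cite: Tate1950, §2.2] -/
theorem adeleAddChar_add_smul (σ : E ≃ₐ[F] E) (x : AdeleRing (𝓞 E) E) : adeleAddChar E (x + σ • x) = adeleAddChar E x ^ 2 := by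
  rw [AddChar.map_add_eq_mul, adeleAddChar_smul F σ x, sq]

/-- **`ψ_E` kills the anti-invariant adeles of an involution**: if `σ • x = −x` then `ψ_E(x) = 1` (`x = x∕2 − σ • (x∕2)`).  For a CM field `L` and
`σ` = complex conjugation this says `ψ_L` is trivial on the «purely imaginary» adeles — the reason the Fourier expansion along the hermitian unipotent
radical `N_Δ ≅ Herm_n` is indexed by hermitian (not all) matrices. [cite: Tate1950, §2.2] [cite: WeilBNT1967, Ch. IV §2] -/
theorem adeleAddChar_eq_one_of_smul_eq_neg (σ : E ≃ₐ[F] E) {x : AdeleRing (𝓞 E) E} (hx : σ • x = -x) : adeleAddChar E x = 1 := by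
  have h2 : (2 : AdeleRing (𝓞 E) E) = algebraMap E (AdeleRing (𝓞 E) E) 2 := by rw [map_ofNat]
  have h2u : IsUnit (2 : AdeleRing (𝓞 E) E) := by rw [h2]; exact (isUnit_iff_ne_zero.2 two_ne_zero).map _
  obtain ⟨t, ht⟩ := h2u
  set y : AdeleRing (𝓞 E) E := (↑t⁻¹ : AdeleRing (𝓞 E) E) * x with hy
  have hσy : σ • y = -y := by
    rw [hy, smul_mul', hx, mul_neg]
    congr 2
    -- `σ • t⁻¹ = t⁻¹`: `t = 2` is rational
    have ht' : σ • (t : AdeleRing (𝓞 E) E) = t := by rw [ht, h2, AdeleRing.smul_algebraMap, map_ofNat]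
    have := congrArg (fun z => σ • (↑t⁻¹ : AdeleRing (𝓞 E) E) * z) ht'
    simp only [← smul_mul', Units.inv_mul, smul_one] at this
    calc σ • (↑t⁻¹ : AdeleRing (𝓞 E) E) = σ • (↑t⁻¹ : AdeleRing (𝓞 E) E) * ((t : AdeleRing (𝓞 E) E) * ↑t⁻¹) := by rw [Units.mul_inv, mul_one]
      _ = ↑t⁻¹ := by rw [← mul_assoc, ← this, one_mul]
  have hxy : x = y - σ • y := by
    rw [hσy, sub_neg_eq_add, hy, ← two_mul, ← ht, ← mul_assoc, Units.mul_inv, one_mul]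
  rw [hxy]
  exact adeleAddChar_sub_smul F σ y

end Literature.NumberTheory.Automorphic

end
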